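import Summits.ResolutionOfSingularities.ResolutionOfSingularities.Theorems.ShadowGameShadowGameWinRRefutation

/-!
# Crux `WinToTorsorLUR` (stmt-ResolutionOfSingularities-18185, route ShadowGame, rev 3) — closed
# VACUOUSLY: its only hypothesis `ShadowGameWinR` is refuted in the tree

`WinToTorsorLUR := ShadowGameWinR → TorsorLUPerfect` (soundness + endgame of the repaired shadow
game).  Its conclusion `TorsorLUPerfect` (local uniformization of `α_p`-torsors over perfect
fields) is implied by the summit, so the crux is unrefutable and a non-vacuous proof would be the
whole soundness dictionary; but its antecedent is FALSE: B wins the repaired game `SG^R_p(3)`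
(`Theorems/ShadowGameShadowGameWinRRefutation.lean`, `not_ShadowGameWinR`, lead of crux 18182;
an independent B-win — the book `x z w (w + z)`, `w = y - xy - x`, over `𝔽₃`, B following the
curve `(t, t/(1-t), 0)` — is recorded in `Cruxes/WinToTorsorLUR/Lines/vacuity.md` by this seat).
Hence the implication holds for nothing, exactly as its rev-2 twin `WinToTorsorLU`
(`Theorems/WinToTorsorLU/Negative/ShadowGameWinFalse.lean`, `winToTorsorLU_iff_true`).
Lead prover-line-stmt-ResolutionOfSingularities-18185-0, 2026-08-17.
-/

set_option linter.dupNamespace false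

namespace Summit.ResolutionOfSingularities.ResolutionOfSingularities.Theorems.WinToTorsorLUR

open Summit.ResolutionOfSingularities.ResolutionOfSingularities.Theses.ShadowGame
  (ShadowGameWinR TorsorLUPerfect WinToTorsorLUR)

/-- **The crux `WinToTorsorLUR` holds (vacuously)**: `ShadowGameWinR → TorsorLUPerfect`, and
`ShadowGameWinR` is false (`Theorems.not_ShadowGameWinR`: B wins `SG^R_p(3)`). [folklore] -/
theorem WinToTorsorLUR_proof : WinToTorsorLUR :=
  fun hW => absurd hW Summit.ResolutionOfSingularities.ResolutionOfSingularities.Theorems.not_ShadowGameWinR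

/-- The crux, as filed, is propositionally `True`. [folklore] -/
theorem winToTorsorLUR_iff_true : WinToTorsorLUR ↔ True :=
  iff_true_intro WinToTorsorLUR_proof

/-- Anatomy: a refutation of the crux would be a winning strategy for A in every `SG^R_p(n)`
together with a failure of torsor local uniformization over some perfect field. [folklore] -/
theorem not_winToTorsorLUR_iff : ¬ WinToTorsorLUR ↔ (ShadowGameWinR ∧ ¬ TorsorLUPerfect) := by
  unfold WinToTorsorLUR; rw [Classical.not_imp]

end Summit.ResolutionOfSingularities.ResolutionOfSingularities.Theorems.WinToTorsorLUR
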